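import Literature.NumberTheory.ModularSymbols.FullLevelHomologyCoeffTwist
import Literature.NumberTheory.ModularSymbols.FullLevelHomologyComplexConj
import Literature.RepresentationTheory.FiniteGroups.GL2ModularPrincipalSeriesTorusLines
import HarnessLib

/-!
# The upstairs twisting operator `T_θ^{up} = Σ_a θ(a)·u(a)` on `H₁(Γ₀(M), k[GL₂(ℤ/p)])`: torus semi-invariance,
# commutation with `M_θ` and `T_q`, and the invariant-to-invariant operator `M_θ ∘ T_θ^{up}`

Topic `Literature/NumberTheory/ModularSymbols`; namespace `Literature.NumberTheory.ModularSymbols.FullLevel`; sequel of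
`FullLevelHomologyCoeffTwist` (`M_θ = H1coeffTwist`, `H1DetEigenspace`), `FullLevelHomologyComplexConj` (`diagTorusEquiv`)
and `FullLevelHomologyHeckeEquivariant` (`heckeT_H1carrierRep`); the unipotents `u(a)` and torus elements `diag(a,b)` are
the tree's `GL2.upperUnip`, `GL2.diagElt` (`Literature/RepresentationTheory/FiniteGroups/GL2ModularPrincipalSeries`), so that a
`GL₂(ℤ/p)`-equivariant map to the Bruhat-coordinate model intertwines `twistUp` with the model's `GL2.coordTwistOp`
VERBATIM (same sum, same elements).  Definitions with bodies + proved theorems; no named fact, no `sorry`, no instance,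
no notation.

* `diagElt_mem_diagTorus`, `exists_diagElt_eq`, `detChar_diagElt` (`θ(det diag(a,b)) = θ(a)θ(b)`),
  **`mem_H1DetEigenspace_iff_diagElt`** (the carrier's eigenspaces in the model's `(a, b)`-convention).
* **`twistUp k p M θ := Σ_{a ∈ ℤ/p} θ(a) · H1carrierRep(u(a))`** (`θ` extended by `0`, `MulChar.ofUnitHom`), `twistUp_apply`;
  `detChar_upperUnip` (`= 1`); **`H1coeffTwist_twistUp`** (`M_{θ'} T_θ = T_θ M_{θ'}`); **`heckeT_twistUp`** (`T_q T_θ = T_θ T_q`);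
  **`H1carrierRep_diagElt_twistUp`** (`diag(a,b) ∘ T_θ = θ(b a⁻¹)·T_θ ∘ diag(a,b)` — the torus normalises the unipotents).
* For an involutive `θ` (`θ(u)² = 1`, the quadratic character): `twistUp_mem_H1DetEigenspace_of_mem_invariants`
  (`T_θ : invariants → Eig(θ)`), `twistUp_mem_invariants_of_mem_H1DetEigenspace` (`Eig(θ) →` invariants),
  `H1coeffTwist_twistUp_mem_invariants`, and **`twistInvariants k p M θ hθ : H₁(…)^{T̃} →ₗ[k] H₁(…)^{T̃}`**,
  `y ↦ M_θ(T_θ^{up} y)` — the operator whose image under the up/down dictionary is (`χ(−1)`·) the twisting operator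
  `Σ_u χ(u)[1 u/p; 0 1]_*` of `H₁(X₀(p²M))` (that comparison is the sequel `FullLevelHomologyTwistComparison`, not here).

Consumer (motivation; nothing about it is asserted here): the K-line of route BSD/TeichmullerTwistDescent (crux
`TwistedPeriodLatticeSaturation`, memo KLINE-COMPOSED §2 (D5) `βW(g·w) = T_χ(βV w)`).

## References
* D. Bump, *Automorphic Forms and Representations* (1997), §4.1 Eq. (1.6)–(1.7). [Bump1997]
* B. Mazur, J. Tate, J. Teitelbaum, Invent. Math. 84 (1986), §I.8 (the twisting operator). [MazurTateTeitelbaum1986]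
* A. Ash, G. Stevens, Duke Math. J. 53 (1986), §1 (1.2)–(1.4). [AshStevens1986]
-/

noncomputable section

namespace Literature.NumberTheory.ModularSymbols

namespace FullLevel

open scoped MatrixGroups
open CategoryTheory CongruenceSubgroup groupHomology Finsupp Matrix
open Literature.Algebra.Homology
open Literature.RepresentationTheory.FiniteGroups

variable (k : Type) [CommRing k] (p M : ℕ) [Fact p.Prime]

/-! ### Torus elements `diag(a,b)` and the carrier's eigenspaces in the `(a,b)`-convention -/

/-- `diag(a, b) ∈ T̃`. [cite: Bump1997, §4.1 Eq. (1.6)] -/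
theorem diagElt_mem_diagTorus (a b : (ZMod p)ˣ) : GL2.diagElt (ZMod p) a b ∈ diagTorus (ZMod p) := by
  rw [mem_diagTorus_iff, GL2.coe_diagElt]
  simp

/-- `diagUnits (a, b) = diag(a, b)` (the two spellings of the tree agree). [cite: Bump1997, §4.1 Eq. (1.6)] -/
theorem diagUnits_eq_diagElt (a b : (ZMod p)ˣ) : diagUnits (a, b) = GL2.diagElt (ZMod p) a b :=
  Matrix.GeneralLinearGroup.ext fun i j => by
    rw [coe_diagUnits, GL2.coe_diagElt]

/-- Every torus element is a `diag(a, b)`. [cite: Bump1997, §4.1 Eq. (1.6)] -/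
theorem exists_diagElt_eq {t : GL (Fin 2) (ZMod p)} (ht : t ∈ diagTorus (ZMod p)) :
    ∃ a b : (ZMod p)ˣ, GL2.diagElt (ZMod p) a b = t := by
  obtain ⟨u, hu⟩ := (diagTorusEquiv (ZMod p)).surjective ⟨t, ht⟩
  refine ⟨u.1, u.2, ?_⟩
  rw [← diagUnits_eq_diagElt]
  exact congrArg Subtype.val hu

/-- `det diag(a, b) = ab`. [cite: Bump1997, §4.1 Eq. (1.6)] -/
theorem det_diagElt (a b : (ZMod p)ˣ) : Matrix.GeneralLinearGroup.det (GL2.diagElt (ZMod p) a b) = a * b := by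
  apply Units.ext
  rw [Matrix.GeneralLinearGroup.val_det_apply, GL2.coe_diagElt, Matrix.det_fin_two_of, Units.val_mul]
  ring

/-- `θ(det diag(a,b)) = θ(a) θ(b)`. [cite: Bump1997, §4.1 Eq. (1.6)] -/
theorem detChar_diagElt (θ : (ZMod p)ˣ →* kˣ) (a b : (ZMod p)ˣ) :
    detChar k p θ (GL2.diagElt (ZMod p) a b) = (θ a : k) * (θ b : k) := by
  rw [detChar, det_diagElt, map_mul, Units.val_mul]

/-- **The carrier's `θ∘det`-eigenspace in the model's convention**:
`z ∈ Eig(θ) ↔ diag(a,b)·z = θ(a)θ(b)·z` for all units `a, b`. [cite: Bump1997, §4.1 Thm. 4.1.1 (proof)] -/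
theorem mem_H1DetEigenspace_iff_diagElt (θ : (ZMod p)ˣ →* kˣ) (z : H1carrier k p M) :
    z ∈ H1DetEigenspace k p M θ ↔
      ∀ a b : (ZMod p)ˣ, H1carrierRep k p M (GL2.diagElt (ZMod p) a b) z = ((θ a : k) * (θ b : k)) • z := by
  rw [mem_H1DetEigenspace_iff]
  constructor
  · intro h a b
    rw [h _ (diagElt_mem_diagTorus p a b), detChar_diagElt]
  · intro h t ht
    obtain ⟨a, b, rfl⟩ := exists_diagElt_eq p ht
    rw [h a b, detChar_diagElt]

/-- `T̃`-invariance in the model's convention: `z` invariant `↔ diag(a,b)·z = z`. [cite: Bump1997, §4.1] -/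
theorem mem_invariants_iff_diagElt (z : H1carrier k p M) :
    z ∈ PermutationCoeff.H1Invariants k (redGL p M) (diagTorus (ZMod p)) ↔
      ∀ a b : (ZMod p)ˣ, H1carrierRep k p M (GL2.diagElt (ZMod p) a b) z = z := by
  rw [← mem_H1DetEigenspace_one_iff, mem_H1DetEigenspace_iff_diagElt]
  simp only [MonoidHom.one_apply, Units.val_one, mul_one, one_smul]

/-! ### The upstairs twisting operator `T_θ^{up} = Σ_a θ(a)·u(a)` -/

/-- **The upstairs twisting operator** `T_θ^{up} := Σ_{a ∈ ℤ/p} θ(a) · H1carrierRep(u(a))` on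
`H₁(Γ₀(M), k[GL₂(ℤ/p)])` (`θ` extended by zero to `ℤ/p` via `MulChar.ofUnitHom`; `u(a) = GL2.upperUnip`).  Under any
`GL₂(ℤ/p)`-equivariant `k`-linear map to the Bruhat-coordinate model `coordRep χ₁ χ₂` it becomes the model's
`GL2.coordTwistOp χ₁ χ₂ (MulChar.ofUnitHom θ)` (same sum). [cite: MazurTateTeitelbaum1986, §I.8; Bump1997, §4.1 Eq. (1.7)] -/
def twistUp (θ : (ZMod p)ˣ →* kˣ) : H1carrier k p M →ₗ[k] H1carrier k p M :=
  ∑ a : ZMod p, MulChar.ofUnitHom θ a • H1carrierRep k p M (GL2.upperUnip (ZMod p) a)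

/-- Unfolding `twistUp`. [cite: MazurTateTeitelbaum1986, §I.8] -/
theorem twistUp_apply (θ : (ZMod p)ˣ →* kˣ) (z : H1carrier k p M) :
    twistUp k p M θ z = ∑ a : ZMod p, MulChar.ofUnitHom θ a • H1carrierRep k p M (GL2.upperUnip (ZMod p) a) z := by
  rw [twistUp, LinearMap.sum_apply]
  rfl

/-- `det u(a) = 1`. [cite: Bump1997, §4.1 Eq. (1.7)] -/
theorem det_upperUnip (a : ZMod p) : Matrix.GeneralLinearGroup.det (GL2.upperUnip (ZMod p) a) = 1 := by
  apply Units.ext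
  rw [Matrix.GeneralLinearGroup.val_det_apply, GL2.coe_upperUnip, Matrix.det_fin_two_of, Units.val_one]
  ring

/-- `θ(det u(a)) = 1`. [cite: Bump1997, §4.1 Eq. (1.7)] -/
@[simp] theorem detChar_upperUnip (θ : (ZMod p)ˣ →* kˣ) (a : ZMod p) :
    detChar k p θ (GL2.upperUnip (ZMod p) a) = 1 := by
  rw [detChar, det_upperUnip, map_one, Units.val_one]

/-- `θ(det u(a)⁻¹) = 1`. [cite: Bump1997, §4.1 Eq. (1.7)] -/
@[simp] theorem detChar_upperUnip_inv (θ : (ZMod p)ˣ →* kˣ) (a : ZMod p) :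
    detChar k p θ (GL2.upperUnip (ZMod p) a)⁻¹ = 1 := by
  have h := detChar_inv_mul k p θ (GL2.upperUnip (ZMod p) a)
  rwa [detChar_upperUnip, mul_one] at h

/-- **`M_{θ'}` commutes with `T_θ^{up}`** (`det u(a) = 1`). [cite: MazurTateTeitelbaum1986, §I.8] -/
theorem H1coeffTwist_twistUp (θ θ' : (ZMod p)ˣ →* kˣ) (z : H1carrier k p M) :
    H1coeffTwist k p M θ' (twistUp k p M θ z) = twistUp k p M θ (H1coeffTwist k p M θ' z) := by
  rw [twistUp_apply, twistUp_apply, map_sum]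
  refine Finset.sum_congr rfl fun a _ => ?_
  rw [map_smul, H1coeffTwist_H1carrierRep, detChar_upperUnip_inv, one_smul]

/-- **`T_q` commutes with `T_θ^{up}`** (`q ∤ pM`): Hecke operators away from `p` commute with the level structure at `p`.
[cite: AshStevens1986, §1 (1.4)] -/
theorem heckeT_twistUp {q : ℕ} [NeZero q] (hq : q.Prime) (hqp : q ≠ p) (θ : (ZMod p)ˣ →* kˣ) (z : H1carrier k p M) :
    heckeT k p M hq hqp (twistUp k p M θ z) = twistUp k p M θ (heckeT k p M hq hqp z) := by
  rw [twistUp_apply, twistUp_apply, map_sum]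
  refine Finset.sum_congr rfl fun a _ => ?_
  rw [map_smul, heckeT_H1carrierRep]

/-- **Torus semi-invariance of `T_θ^{up}`**: `diag(a,b)·(T_θ z) = θ(b/a)·T_θ(diag(a,b)·z)`, because
`diag(a,b) u(s) = u(as/b) diag(a,b)` and `Σ_s θ(s) u(as/b) = θ(b/a) Σ_s θ(s) u(s)`. [cite: Bump1997, §4.1 Eq. (1.7)] -/
theorem H1carrierRep_diagElt_twistUp (θ : (ZMod p)ˣ →* kˣ) (a b : (ZMod p)ˣ) (z : H1carrier k p M) :
    H1carrierRep k p M (GL2.diagElt (ZMod p) a b) (twistUp k p M θ z) =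
      MulChar.ofUnitHom θ ((b : ZMod p) / a) • twistUp k p M θ (H1carrierRep k p M (GL2.diagElt (ZMod p) a b) z) := by
  have hc : (a : ZMod p) / b ≠ 0 := div_ne_zero a.ne_zero b.ne_zero
  rw [twistUp_apply, twistUp_apply, map_sum, Finset.smul_sum]
  have e1 : ∀ s : ZMod p, H1carrierRep k p M (GL2.diagElt (ZMod p) a b)
      (MulChar.ofUnitHom θ s • H1carrierRep k p M (GL2.upperUnip (ZMod p) s) z) =
      MulChar.ofUnitHom θ s • H1carrierRep k p M (GL2.upperUnip (ZMod p) (s * ((a : ZMod p) / b)))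
        (H1carrierRep k p M (GL2.diagElt (ZMod p) a b) z) := fun s => by
    rw [map_smul, ← Module.End.mul_apply, ← map_mul, GL2.diagElt_mul_upperUnip, map_mul, Module.End.mul_apply]
    congr 3
    ring
  simp_rw [e1]
  refine Fintype.sum_equiv (Equiv.mulRight₀ ((a : ZMod p) / b) hc) _ _ fun s => ?_
  simp only [Equiv.mulRight₀_apply]
  rw [smul_smul, ← map_mul]
  congr 2
  field_simp

/-- For an involutive character: `θ(b/a) = θ(a)θ(b)` (in `k`). [cite: Bump1997, §4.1] -/
theorem ofUnitHom_div_of_mul_self (θ : (ZMod p)ˣ →* kˣ) (hθ : ∀ u, θ u * θ u = 1) (a b : (ZMod p)ˣ) :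
    MulChar.ofUnitHom θ ((b : ZMod p) / a) = (θ a : k) * (θ b : k) := by
  have hab : ((b : ZMod p) / a) = ((b * a⁻¹ : (ZMod p)ˣ) : ZMod p) := by
    rw [Units.val_mul, Units.val_inv_eq_inv_val, div_eq_mul_inv]
  rw [hab, MulChar.ofUnitHom_coe, map_mul, Units.val_mul, mul_comm]
  congr 1
  have h : θ a⁻¹ = θ a := by
    rw [map_inv, inv_eq_iff_mul_eq_one, hθ]
  rw [h]

/-- **`T_θ^{up}` maps `Eig(θ')` to `Eig(θθ')`** for an involutive `θ`. [cite: Bump1997, §4.1 Eq. (1.7)] -/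
theorem twistUp_mem_H1DetEigenspace (θ θ' : (ZMod p)ˣ →* kˣ) (hθ : ∀ u, θ u * θ u = 1) {z : H1carrier k p M}
    (hz : z ∈ H1DetEigenspace k p M θ') : twistUp k p M θ z ∈ H1DetEigenspace k p M (θ * θ') := by
  rw [mem_H1DetEigenspace_iff_diagElt] at hz ⊢
  intro a b
  rw [H1carrierRep_diagElt_twistUp, hz a b, map_smul, smul_smul, ofUnitHom_div_of_mul_self k p θ hθ,
    MonoidHom.mul_apply, MonoidHom.mul_apply, Units.val_mul, Units.val_mul]
  congr 1
  ring

/-- `T_θ^{up}` maps `T̃`-invariants to `θ∘det`-eigenvectors (involutive `θ`). [cite: Bump1997, §4.1 Eq. (1.7)] -/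
theorem twistUp_mem_H1DetEigenspace_of_mem_invariants (θ : (ZMod p)ˣ →* kˣ) (hθ : ∀ u, θ u * θ u = 1)
    {z : H1carrier k p M} (hz : z ∈ PermutationCoeff.H1Invariants k (redGL p M) (diagTorus (ZMod p))) :
    twistUp k p M θ z ∈ H1DetEigenspace k p M θ := by
  have h := twistUp_mem_H1DetEigenspace k p M θ 1 hθ ((mem_H1DetEigenspace_one_iff k p M z).2 hz)
  rw [mem_H1DetEigenspace_iff_diagElt] at h ⊢
  intro a b
  rw [h a b, MonoidHom.mul_apply, MonoidHom.mul_apply, MonoidHom.one_apply, MonoidHom.one_apply, mul_one, mul_one]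

/-- `T_θ^{up}` maps `θ∘det`-eigenvectors to `T̃`-invariants (involutive `θ`). [cite: Bump1997, §4.1 Eq. (1.7)] -/
theorem twistUp_mem_invariants_of_mem_H1DetEigenspace (θ : (ZMod p)ˣ →* kˣ) (hθ : ∀ u, θ u * θ u = 1)
    {z : H1carrier k p M} (hz : z ∈ H1DetEigenspace k p M θ) :
    twistUp k p M θ z ∈ PermutationCoeff.H1Invariants k (redGL p M) (diagTorus (ZMod p)) := by
  have h := twistUp_mem_H1DetEigenspace k p M θ θ hθ hz
  rw [mem_H1DetEigenspace_iff_diagElt] at h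
  rw [mem_invariants_iff_diagElt]
  intro a b
  rw [h a b, MonoidHom.mul_apply, MonoidHom.mul_apply, Units.val_mul, Units.val_mul]
  have ha : (θ a : k) * (θ a : k) = 1 := by rw [← Units.val_mul, hθ, Units.val_one]
  have hb : (θ b : k) * (θ b : k) = 1 := by rw [← Units.val_mul, hθ, Units.val_one]
  rw [show (θ a : k) * (θ a : k) * ((θ b : k) * (θ b : k)) = 1 by rw [ha, hb, mul_one], one_smul]

/-- For `y` invariant and `θ` involutive, `M_θ(T_θ^{up} y)` is again `T̃`-invariant. [cite: MazurTateTeitelbaum1986, §I.8] -/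
theorem H1coeffTwist_twistUp_mem_invariants (θ : (ZMod p)ˣ →* kˣ) (hθ : ∀ u, θ u * θ u = 1)
    {y : H1carrier k p M} (hy : y ∈ PermutationCoeff.H1Invariants k (redGL p M) (diagTorus (ZMod p))) :
    H1coeffTwist k p M θ (twistUp k p M θ y) ∈ PermutationCoeff.H1Invariants k (redGL p M) (diagTorus (ZMod p)) :=
  H1coeffTwist_mem_invariants_of_mem_H1DetEigenspace k p M θ θ hθ
    (twistUp_mem_H1DetEigenspace_of_mem_invariants k p M θ hθ hy)

/-- **The invariant-to-invariant twisting operator** `y ↦ M_θ(T_θ^{up} y)` on `H₁(Γ₀(M), k[GL₂(ℤ/p)])^{T̃}` (involutive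
`θ`).  Its image under the up/down dictionary `H₁(…)^{T̃} ↠ H₁(X₀(p²M), k)` is `θ(−1)` times the twisting operator
`Σ_u θ(u)[1 u/p; 0 1]_*` (sequel). [cite: MazurTateTeitelbaum1986, §I.8] -/
def twistInvariants (θ : (ZMod p)ˣ →* kˣ) (hθ : ∀ u, θ u * θ u = 1) :
    PermutationCoeff.H1Invariants k (redGL p M) (diagTorus (ZMod p)) →ₗ[k]
      PermutationCoeff.H1Invariants k (redGL p M) (diagTorus (ZMod p)) where
  toFun y := ⟨H1coeffTwist k p M θ (twistUp k p M θ y.1), H1coeffTwist_twistUp_mem_invariants k p M θ hθ y.2⟩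
  map_add' y₁ y₂ := Subtype.ext (by simp only [Submodule.coe_add, map_add])
  map_smul' c y := Subtype.ext (by simp only [Submodule.coe_smul, map_smul, RingHom.id_apply])

/-- Unfolding `twistInvariants`. [cite: MazurTateTeitelbaum1986, §I.8] -/
theorem coe_twistInvariants (θ : (ZMod p)ˣ →* kˣ) (hθ : ∀ u, θ u * θ u = 1)
    (y : PermutationCoeff.H1Invariants k (redGL p M) (diagTorus (ZMod p))) :
    (twistInvariants k p M θ hθ y : H1carrier k p M) = H1coeffTwist k p M θ (twistUp k p M θ y.1) := rfl

end FullLevel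

end Literature.NumberTheory.ModularSymbols
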